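import Literature.NumberTheory.GaloisRepresentations.FaltingsSerreGSp4
import Literature.NumberTheory.FaltingsSerre.CriterionProofs
import HarnessLib

/-!
# The effective Faltings–Serre criterion for `GSp₄` at `ℓ = 2` over `ℚ` HOLDS

This file DISCHARGES the named fact
`Literature.NumberTheory.GaloisRepresentations.BrumerEtAl2019.faltingsSerre_GSp4_two`
(`FaltingsSerreGSp4.lean`: [BrumerEtAl2019] = Brumer–Pacetti–Poor–Tornaría–Voight–Yuen, *On the
paramodularity of typical abelian surfaces*, Algebra & Number Theory 13:5 (2019), Thm 2.1.5 /
Algorithm 2.4.1 with Remark 2.4.2, specialised to `F = ℚ`, `ℓ = 2`, `G = GSp₄`, equal similitude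
characters) by combining two PROVED results of the tree:

* `BrumerEtAl2019.faltingsSerre_GSp4_two_of_traceEq` (same file): the Galois-specialised statement
  follows from the abstract criterion `FaltingsSerre.traceEq_of_faltingsSerre_symplectic`;
* `FaltingsSerre.traceEq_of_faltingsSerre_symplectic_holds`
  (`Literature/NumberTheory/FaltingsSerre/CriterionProofs.lean`): the abstract criterion holds.

Kept in a separate file so that `FaltingsSerreGSp4.lean` (definitions + named fact) is untouched.

## References

* [BrumerEtAl2019] A. Brumer, A. Pacetti, C. Poor, G. Tornaría, J. Voight, D. S. Yuen, ANT 13:5 (2019)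
  1145–1195: Thm 2.1.5 p. 1150, Algorithm 2.4.1 pp. 1156–1157, Remark 2.4.2 p. 1156.
  [cite: BrumerEtAl2019]
-/

namespace Literature.NumberTheory.GaloisRepresentations.BrumerEtAl2019

/-- **The effective Faltings–Serre criterion for `GSp₄` at `ℓ = 2` over `ℚ` holds** (discharge of the
named fact `faltingsSerre_GSp4_two`): the abstract criterion is a theorem
(`FaltingsSerre.traceEq_of_faltingsSerre_symplectic_holds`) and `faltingsSerre_GSp4_two_of_traceEq`
reduces this fact to it. [cite: BrumerEtAl2019, Thm 2.1.5 and Alg 2.4.1] -/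
theorem faltingsSerre_GSp4_two_holds : faltingsSerre_GSp4_two :=
  faltingsSerre_GSp4_two_of_traceEq FaltingsSerre.traceEq_of_faltingsSerre_symplectic_holds

end Literature.NumberTheory.GaloisRepresentations.BrumerEtAl2019
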